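import Mathlib
import Summits.Ventures.PercRepro2.CoinChainXAGateBridge
import Summits.Ventures.PercRepro2.CoinChainXAGMFact
import Summits.Ventures.PercRepro2.CoinChainXAGR1Fact

/-!
# The gate law's covariance about the world-0 means is nonnegative — for EVERY admissible gate
(blind cell PercRepro2, night-2 g34; proofs/NIGHT2-DARC.md §74)

`U001(G¹) = Σ_W G¹(W)·(L·x(W) − Px)·(L·y(W) − Py)` — the "positive side" of the cleared (XA′) `Cross ≤ L·U001` — is
nonnegative for every admissible gate `d'` (`0 ≤ d' ≤ d`, log-supermodular, `d·d'`-monotone), any entry structure: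
with `g = (g₀, g₁, g₂, g₁₂)` the moments of the gate law `G¹ = (c on I, d' on D' ∪ M)` and the three whole-lattice
Ahlswede–Daykin facts at the gate law, `GM: L·g₁₂ ≥ Py·g₁`, `GMp: L·g₁₂ ≥ Px·g₂`, `GR1: g₀·g₁₂ ≥ g₁·g₂`,

  `U001 = L·GM − Px·ĝy = L·GMp − Py·ĝx`,   `g₀·(L·GM − Px·ĝy) = L²·GR1 + ĝx·ĝy`   (`ĝ = L·g − P·g₀` the gate shifts),

so `U001 ≥ 0` in the three cases `ĝy ≤ 0`, `ĝx ≤ 0`, `ĝx, ĝy > 0` (`cov_nonneg_of_three_facts`, seven variables).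
Consequently the cleared (XA′) at ANY admissible gate is the single inequality

  `L·U001(G¹) + Sx·κ̂ᴹy + Sy·κ̂ᴹx ≥ 0`,   `κ̂ᴹ = Σ_M ν(d − d')·(L·marker − P)` the shifts of the gate-KILLED law on the `m`-clusters,

whose first term is ≥ 0 by this file: «the covariance dominates the shift product» is the whole content of the general
gate (the M-open gates, `κᴹ = 0`, are `chain_XA'_mopen_gate`; the M-supported gates are `chain_XA'_mgate`).
-/

namespace Summit.Ventures.PercRepro2.Coin

open Classical

section GateFacts

variable {V : Type*} [DecidableEq V] {R : Type*} [Field R] [LinearOrder R] [IsStrictOrderedRing R]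

/-- The `(c, d')` law of an admissible gate: `c(s)·d'(t) ≤ c(s ∩ t)·d'(s ∪ t)`, from `hcd` and the ratio monotonicity
`d(s ∪ t)·d'(t) ≤ d(t)·d'(s ∪ t)` contained in `hdd'` (the degenerate cases `d(t) = 0`, `d(s ∪ t) = 0` separately). -/
theorem gate_cd_law (c d d' : Finset V → R) (hc0 : ∀ W, 0 ≤ c W) (hd0 : ∀ W, 0 ≤ d W)
    (hd'0 : ∀ W, 0 ≤ d' W) (hd'd : ∀ W, d' W ≤ d W)
    (hcd : ∀ s t, c s * d t ≤ c (s ∩ t) * d (s ∪ t))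
    (hdd' : ∀ s t, d s * d' t ≤ d (s ∩ t) * d' (s ∪ t)) (s t : Finset V) :
    c s * d' t ≤ c (s ∩ t) * d' (s ∪ t) := by
  have h1 := hcd s t
  have h2 := hdd' (s ∪ t) t
  rw [show (s ∪ t) ∩ t = t from Finset.union_inter_cancel_right, Finset.union_right_idem s t] at h2
  have hR0 : 0 ≤ c (s ∩ t) * d' (s ∪ t) := mul_nonneg (hc0 _) (hd'0 _)
  rcases lt_or_eq_of_le (hd0 t) with hdt | hdt
  · rcases lt_or_eq_of_le (hd0 (s ∪ t)) with hdst | hdst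
    · have hprod := mul_le_mul h1 h2 (mul_nonneg (hd0 _) (hd'0 _)) (mul_nonneg (hc0 _) (hd0 _))
      have key : (c s * d' t) * (d t * d (s ∪ t)) ≤ (c (s ∩ t) * d' (s ∪ t)) * (d t * d (s ∪ t)) := by
        linarith [hprod]
      exact le_of_mul_le_mul_right key (mul_pos hdt hdst)
    · have hcs : c s * d t = 0 := by
        apply le_antisymm _ (mul_nonneg (hc0 _) (hd0 _)); rw [← hdst, mul_zero] at h1; exact h1
      have hc : c s = 0 := by
        rcases mul_eq_zero.1 hcs with h | h
        · exact h
        · exact absurd h hdt.ne'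
      rw [hc, zero_mul]; exact hR0
  · have hd't : d' t = 0 := le_antisymm (by rw [hdt]; exact hd'd t) (hd'0 t)
    rw [hd't, mul_zero]; exact hR0

/-- The pointwise law inequality of the `GM` fact AT THE GATE LAW: `d'(s)·μ(t) ≤ μ(s ∩ t)·d'(s ∪ t)` for the world-0
law `μ = (d on the m-clusters, c elsewhere)` — from `hdd'`, `d ≤ c` and the `(c, d')` law. -/
theorem gmg_law_pw (m : V) (c d d' : Finset V → R) (hd'0 : ∀ W, 0 ≤ d' W) (hdc : ∀ W, d W ≤ c W)
    (hcd' : ∀ s t, c s * d' t ≤ c (s ∩ t) * d' (s ∪ t)) (hdd' : ∀ s t, d s * d' t ≤ d (s ∩ t) * d' (s ∪ t)) (s t : Finset V) :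
    d' s * (if ∃ r ∈ ({m} : Finset V), r ∈ t then d t else c t) ≤
      (if ∃ r ∈ ({m} : Finset V), r ∈ s ∩ t then d (s ∩ t) else c (s ∩ t)) * d' (s ∪ t) := by
  by_cases hs : m ∈ s <;> by_cases ht : m ∈ t
  · have h1 : ∃ r ∈ ({m} : Finset V), r ∈ t := ⟨m, Finset.mem_singleton_self m, ht⟩
    have h2 : ∃ r ∈ ({m} : Finset V), r ∈ s ∩ t := ⟨m, Finset.mem_singleton_self m, Finset.mem_inter.2 ⟨hs, ht⟩⟩
    rw [if_pos h1, if_pos h2]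
    calc d' s * d t = d t * d' s := by ring
      _ ≤ d (t ∩ s) * d' (t ∪ s) := hdd' t s
      _ = d (s ∩ t) * d' (s ∪ t) := by rw [Finset.inter_comm, Finset.union_comm]
  · have h1 : ¬ ∃ r ∈ ({m} : Finset V), r ∈ t := fun ⟨r, hr, hrt⟩ => ht (Finset.mem_singleton.1 hr ▸ hrt)
    have h2 : ¬ ∃ r ∈ ({m} : Finset V), r ∈ s ∩ t := fun ⟨r, hr, hrt⟩ => ht (Finset.mem_singleton.1 hr ▸ (Finset.mem_inter.1 hrt).2)
    rw [if_neg h1, if_neg h2]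
    calc d' s * c t = c t * d' s := by ring
      _ ≤ c (t ∩ s) * d' (t ∪ s) := hcd' t s
      _ = c (s ∩ t) * d' (s ∪ t) := by rw [Finset.inter_comm, Finset.union_comm]
  · have h1 : ∃ r ∈ ({m} : Finset V), r ∈ t := ⟨m, Finset.mem_singleton_self m, ht⟩
    have h2 : ¬ ∃ r ∈ ({m} : Finset V), r ∈ s ∩ t := fun ⟨r, hr, hrt⟩ => hs (Finset.mem_singleton.1 hr ▸ (Finset.mem_inter.1 hrt).1)
    rw [if_pos h1, if_neg h2]
    calc d' s * d t = d t * d' s := by ring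
      _ ≤ d (t ∩ s) * d' (t ∪ s) := hdd' t s
      _ = d (s ∩ t) * d' (s ∪ t) := by rw [Finset.inter_comm, Finset.union_comm]
      _ ≤ c (s ∩ t) * d' (s ∪ t) := mul_le_mul_of_nonneg_right (hdc _) (hd'0 _)
  · have h1 : ¬ ∃ r ∈ ({m} : Finset V), r ∈ t := fun ⟨r, hr, hrt⟩ => ht (Finset.mem_singleton.1 hr ▸ hrt)
    have h2 : ¬ ∃ r ∈ ({m} : Finset V), r ∈ s ∩ t := fun ⟨r, hr, hrt⟩ => ht (Finset.mem_singleton.1 hr ▸ (Finset.mem_inter.1 hrt).2)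
    rw [if_neg h1, if_neg h2]
    calc d' s * c t = c t * d' s := by ring
      _ ≤ c (t ∩ s) * d' (t ∪ s) := hcd' t s
      _ = c (s ∩ t) * d' (s ∪ t) := by rw [Finset.inter_comm, Finset.union_comm]

/-- **The `GM` fact at the gate law** `(XWD + XWM)·Py ≤ L·(XYWD + XYWM)`: the `j`-marked part of the gate law is
`y`-richer than the world-0 law `R⁰` — one set-level four-functions instance with `L₁ = νd'·x`, `L₂ = R⁰·y`, `L₃ = R⁰`,
`L₄ = νd'·xy` (`gmg_law_pw`). -/
theorem cg_fact_GMg (U : Finset V) (m : V) (ent' : Finset V) (ν c d d' : Finset V → R)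
    (hν0 : ∀ W, 0 ≤ ν W) (hν : ∀ s ⊆ U, ∀ t ⊆ U, ν s * ν t ≤ ν (s ∩ t) * ν (s ∪ t))
    (hc0 : ∀ W, 0 ≤ c W) (hd0 : ∀ W, 0 ≤ d W) (hdc : ∀ W, d W ≤ c W)
    (hd'0 : ∀ W, 0 ≤ d' W)
    (hcd' : ∀ s t, c s * d' t ≤ c (s ∩ t) * d' (s ∪ t)) (hdd' : ∀ s t, d s * d' t ≤ d (s ∩ t) * d' (s ∪ t))
    (x y : Finset V → R) (hx0 : ∀ W, 0 ≤ x W) (hy0 : ∀ W, 0 ≤ y W)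
    (hxm : ∀ s t, x s ≤ x (s ∪ t)) (hym : ∀ s t, y s ≤ y (s ∪ t))
    (hxI : ∀ W, (¬ ∃ r ∈ ({m} : Finset V) ∪ ent', r ∈ W) → x W = 0)
    (hyI : ∀ W, (¬ ∃ r ∈ ({m} : Finset V) ∪ ent', r ∈ W) → y W = 0) :
    ((∑ W ∈ U.powerset.filter (fun W => (¬ ∃ r ∈ ({m} : Finset V), r ∈ W) ∧ ∃ r ∈ ent', r ∈ W), ν W * d' W * x W)
        + (∑ W ∈ U.powerset.filter (fun W => ∃ r ∈ ({m} : Finset V), r ∈ W), ν W * d' W * x W))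
      * ((∑ W ∈ U.powerset.filter (fun W => (¬ ∃ r ∈ ({m} : Finset V), r ∈ W) ∧ ∃ r ∈ ent', r ∈ W), ν W * (c W - d W) * y W)
        + (∑ W ∈ U.powerset.filter (fun W => (¬ ∃ r ∈ ({m} : Finset V), r ∈ W) ∧ ∃ r ∈ ent', r ∈ W), ν W * d W * y W)
        + (∑ W ∈ U.powerset.filter (fun W => ∃ r ∈ ({m} : Finset V), r ∈ W), ν W * d W * y W)) ≤
    ((∑ W ∈ U.powerset.filter (fun W => ¬ ∃ r ∈ ({m} : Finset V) ∪ ent', r ∈ W), ν W * c W)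
        + (∑ W ∈ U.powerset.filter (fun W => (¬ ∃ r ∈ ({m} : Finset V), r ∈ W) ∧ ∃ r ∈ ent', r ∈ W), ν W * (c W - d W))
        + (∑ W ∈ U.powerset.filter (fun W => (¬ ∃ r ∈ ({m} : Finset V), r ∈ W) ∧ ∃ r ∈ ent', r ∈ W), ν W * d W)
        + (∑ W ∈ U.powerset.filter (fun W => ∃ r ∈ ({m} : Finset V), r ∈ W), ν W * d W))
      * ((∑ W ∈ U.powerset.filter (fun W => (¬ ∃ r ∈ ({m} : Finset V), r ∈ W) ∧ ∃ r ∈ ent', r ∈ W), ν W * d' W * (x W * y W))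
        + (∑ W ∈ U.powerset.filter (fun W => ∃ r ∈ ({m} : Finset V), r ∈ W), ν W * d' W * (x W * y W))) := by
  set μ : Finset V → R := fun W => if ∃ r ∈ ({m} : Finset V), r ∈ W then d W else c W with hμ
  have hμ0 : ∀ W, 0 ≤ μ W := fun W => by simp only [hμ]; split_ifs <;> [exact hd0 W; exact hc0 W]
  have key := ad_sets_dec U (fun W => ν W * d' W * x W) (fun W => ν W * μ W * y W) (fun W => ν W * μ W)
    (fun W => ν W * d' W * (x W * y W))
    (fun W => mul_nonneg (mul_nonneg (hν0 W) (hd'0 W)) (hx0 W)) (fun W => mul_nonneg (mul_nonneg (hν0 W) (hμ0 W)) (hy0 W))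
    (fun W => mul_nonneg (hν0 W) (hμ0 W)) (fun W => mul_nonneg (mul_nonneg (hν0 W) (hd'0 W)) (mul_nonneg (hx0 W) (hy0 W)))
    (fun _ => True) (fun _ => True) (fun _ => True) (fun _ => True) (by
      intro s hs t ht _ _
      refine ⟨trivial, trivial, ?_⟩
      have hxt : x s ≤ x (s ∪ t) := hxm s t
      have hyt : y t ≤ y (s ∪ t) := by rw [Finset.union_comm]; exact hym t s
      have hlaw : d' s * μ t ≤ μ (s ∩ t) * d' (s ∪ t) := by
        simp only [hμ]; exact gmg_law_pw m c d d' hd'0 hdc hcd' hdd' s t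
      calc ν s * d' s * x s * (ν t * μ t * y t) = (ν s * ν t) * (d' s * μ t) * (x s * y t) := by ring
        _ ≤ (ν (s ∩ t) * ν (s ∪ t)) * (μ (s ∩ t) * d' (s ∪ t)) * (x (s ∪ t) * y (s ∪ t)) :=
            mul_le_mul (mul_le_mul (hν s hs t ht) hlaw (mul_nonneg (hd'0 s) (hμ0 t)) (mul_nonneg (hν0 _) (hν0 _)))
              (mul_le_mul hxt hyt (hy0 t) (hx0 _)) (mul_nonneg (hx0 s) (hy0 t))
              (mul_nonneg (mul_nonneg (hν0 _) (hν0 _)) (mul_nonneg (hμ0 _) (hd'0 _)))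
        _ = ν (s ∩ t) * μ (s ∩ t) * (ν (s ∪ t) * d' (s ∪ t) * (x (s ∪ t) * y (s ∪ t))) := by ring)
  simp only [Finset.filter_true] at key
  rw [sum_three_regions U {m} ent', sum_three_regions U {m} ent' (fun W => ν W * μ W * y W),
    sum_three_regions U {m} ent' (fun W => ν W * μ W), sum_three_regions U {m} ent' (fun W => ν W * d' W * (x W * y W))] at key
  have hI1 : (∑ W ∈ U.powerset.filter (fun W => ¬ ∃ r ∈ ({m} : Finset V) ∪ ent', r ∈ W), ν W * d' W * x W) = 0 :=
    cgate_sum_zero U _ _ (fun W hW => by rw [hxI W hW, mul_zero])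
  have hI2 : (∑ W ∈ U.powerset.filter (fun W => ¬ ∃ r ∈ ({m} : Finset V) ∪ ent', r ∈ W), ν W * μ W * y W) = 0 :=
    cgate_sum_zero U _ _ (fun W hW => by rw [hyI W hW, mul_zero])
  have hI4 : (∑ W ∈ U.powerset.filter (fun W => ¬ ∃ r ∈ ({m} : Finset V) ∪ ent', r ∈ W), ν W * d' W * (x W * y W)) = 0 :=
    cgate_sum_zero U _ _ (fun W hW => by rw [hxI W hW, zero_mul, mul_zero])
  have hI3 : (∑ W ∈ U.powerset.filter (fun W => ¬ ∃ r ∈ ({m} : Finset V) ∪ ent', r ∈ W), ν W * μ W)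
      = ∑ W ∈ U.powerset.filter (fun W => ¬ ∃ r ∈ ({m} : Finset V) ∪ ent', r ∈ W), ν W * c W :=
    Finset.sum_congr rfl (fun W hW => by
      have h := (Finset.mem_filter.1 hW).2
      have hm : ¬ ∃ r ∈ ({m} : Finset V), r ∈ W := fun ⟨r, hr, hrW⟩ => h ⟨r, Finset.mem_union.2 (Or.inl hr), hrW⟩
      simp only [hμ, if_neg hm])
  have hD2 : (∑ W ∈ U.powerset.filter (fun W => (¬ ∃ r ∈ ({m} : Finset V), r ∈ W) ∧ ∃ r ∈ ent', r ∈ W), ν W * μ W * y W)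
      = ∑ W ∈ U.powerset.filter (fun W => (¬ ∃ r ∈ ({m} : Finset V), r ∈ W) ∧ ∃ r ∈ ent', r ∈ W), ν W * c W * y W :=
    Finset.sum_congr rfl (fun W hW => by simp only [hμ, if_neg (Finset.mem_filter.1 hW).2.1])
  have hD3 : (∑ W ∈ U.powerset.filter (fun W => (¬ ∃ r ∈ ({m} : Finset V), r ∈ W) ∧ ∃ r ∈ ent', r ∈ W), ν W * μ W)
      = ∑ W ∈ U.powerset.filter (fun W => (¬ ∃ r ∈ ({m} : Finset V), r ∈ W) ∧ ∃ r ∈ ent', r ∈ W), ν W * c W :=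
    Finset.sum_congr rfl (fun W hW => by simp only [hμ, if_neg (Finset.mem_filter.1 hW).2.1])
  have hM2 : (∑ W ∈ U.powerset.filter (fun W => ∃ r ∈ ({m} : Finset V), r ∈ W), ν W * μ W * y W)
      = ∑ W ∈ U.powerset.filter (fun W => ∃ r ∈ ({m} : Finset V), r ∈ W), ν W * d W * y W :=
    Finset.sum_congr rfl (fun W hW => by simp only [hμ, if_pos (Finset.mem_filter.1 hW).2])
  have hM3 : (∑ W ∈ U.powerset.filter (fun W => ∃ r ∈ ({m} : Finset V), r ∈ W), ν W * μ W)
      = ∑ W ∈ U.powerset.filter (fun W => ∃ r ∈ ({m} : Finset V), r ∈ W), ν W * d W :=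
    Finset.sum_congr rfl (fun W hW => by simp only [hμ, if_pos (Finset.mem_filter.1 hW).2])
  rw [hI1, hI2, hI3, hI4, hD2, hD3, hM2, hM3, zero_add, zero_add, zero_add,
    cg_split U ν c d (fun W => (¬ ∃ r ∈ ({m} : Finset V), r ∈ W) ∧ ∃ r ∈ ent', r ∈ W) y,
    cg_split' U ν c d (fun W => (¬ ∃ r ∈ ({m} : Finset V), r ∈ W) ∧ ∃ r ∈ ent', r ∈ W)] at key
  linear_combination key

end GateFacts

section CovCore

variable {R : Type*} [Field R] [LinearOrder R] [IsStrictOrderedRing R]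

/-- **THE COVARIANCE ABOUT FOREIGN MEANS IS NONNEGATIVE** from the three facts `GM`, `GMp`, `GR1`: for
`L, Px, Py, g₀ ≥ 0`, `L·g₁₂ ≥ Py·g₁`, `L·g₁₂ ≥ Px·g₂`, `g₀·g₁₂ ≥ g₁·g₂`,
`0 ≤ L²·g₁₂ − L·Py·g₁ − L·Px·g₂ + Px·Py·g₀`. -/
theorem cov_nonneg_of_three_facts (L Px Py g0 g1 g2 g12 : R)
    (hL : 0 ≤ L) (hPx : 0 ≤ Px) (hPy : 0 ≤ Py) (hg0 : 0 ≤ g0)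
    (hGM : Py * g1 ≤ L * g12) (hGMp : Px * g2 ≤ L * g12) (hGR1 : g1 * g2 ≤ g0 * g12) :
    0 ≤ L * L * g12 - L * Py * g1 - L * Px * g2 + Px * Py * g0 := by
  have e1 : L * L * g12 - L * Py * g1 - L * Px * g2 + Px * Py * g0 = L * (L * g12 - Py * g1) - Px * (L * g2 - Py * g0) := by ring
  have e2 : L * (L * g12 - Py * g1) - Px * (L * g2 - Py * g0) = L * (L * g12 - Px * g2) - Py * (L * g1 - Px * g0) := by ring
  have e3 : g0 * (L * (L * g12 - Py * g1) - Px * (L * g2 - Py * g0)) = L ^ 2 * (g0 * g12 - g1 * g2) + (L * g1 - Px * g0) * (L * g2 - Py * g0) := by ring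
  rw [e1]
  rcases le_or_gt (L * g2 - Py * g0) 0 with hgy | hgy
  · nlinarith [mul_nonneg hL (sub_nonneg.2 hGM), mul_nonneg hPx (neg_nonneg.2 hgy)]
  rcases le_or_gt (L * g1 - Px * g0) 0 with hgx | hgx
  · rw [e2]; nlinarith [mul_nonneg hL (sub_nonneg.2 hGMp), mul_nonneg hPy (neg_nonneg.2 hgx)]
  have hpos : 0 < g0 * (L * (L * g12 - Py * g1) - Px * (L * g2 - Py * g0)) := by
    rw [e3]; exact add_pos_of_nonneg_of_pos (mul_nonneg (sq_nonneg L) (sub_nonneg.2 hGR1)) (mul_pos hgx hgy)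
  rcases lt_or_eq_of_le hg0 with h0 | h0
  · exact ((mul_pos_iff_of_pos_left h0).mp hpos).le
  · rw [← h0, zero_mul] at hpos; exact absurd hpos (lt_irrefl 0)

end CovCore

section CovChain

variable {V : Type*} [DecidableEq V] {R : Type*} [Field R] [LinearOrder R] [IsStrictOrderedRing R]

set_option maxHeartbeats 4000000 in
/-- **`U001(G¹) ≥ 0` FOR EVERY ADMISSIBLE GATE OF THE CHAIN**: `ent = {m}`, any `ent' ∋ j, j'`, the entry markers, any
gate `d'` with `0 ≤ d' ≤ d`, `d'` log-supermodular and `hdd'`: the covariance of the two markers under the gate law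
`G¹ = ν·chainMix {m} ent' 1 c d'` about the means of the world-0 law `R⁰ = ν·chainMix {m} ent' 0 c d` is nonnegative
(the facts `GM`, `GMp`, `GR1` at the gate law, then `cov_nonneg_of_three_facts`). -/
theorem chain_gate_cov_nonneg (U : Finset V) (m j j' : V) (ent' : Finset V) (ν c d d' : Finset V → R)
    (hj : j ∈ ent') (hj' : j' ∈ ent')
    (hν0 : ∀ W, 0 ≤ ν W) (hν : ∀ s ⊆ U, ∀ t ⊆ U, ν s * ν t ≤ ν (s ∩ t) * ν (s ∪ t))
    (hc0 : ∀ W, 0 ≤ c W) (hd0 : ∀ W, 0 ≤ d W) (hdc : ∀ W, d W ≤ c W)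
    (hcd : ∀ s t, c s * d t ≤ c (s ∩ t) * d (s ∪ t))
    (hd'0 : ∀ W, 0 ≤ d' W) (hd'd : ∀ W, d' W ≤ d W)
    (hd'd' : ∀ s t, d' s * d' t ≤ d' (s ∩ t) * d' (s ∪ t))
    (hdd' : ∀ s t, d s * d' t ≤ d (s ∩ t) * d' (s ∪ t))
    (x y : Finset V → R) (hx : ∀ W, x W = if j ∈ W then 1 else 0) (hy : ∀ W, y W = if j' ∈ W then 1 else 0) :
    0 ≤ ((∑ W ∈ U.powerset, ν W * chainMix {m} ent' 0 c d W) * (∑ W ∈ U.powerset, ν W * chainMix {m} ent' 0 c d W) * (∑ W ∈ U.powerset, ν W * chainMix {m} ent' 1 c d' W * (x W * y W))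
          - (∑ W ∈ U.powerset, ν W * chainMix {m} ent' 0 c d W) * (∑ W ∈ U.powerset, ν W * chainMix {m} ent' 0 c d W * y W) * (∑ W ∈ U.powerset, ν W * chainMix {m} ent' 1 c d' W * x W)
          - (∑ W ∈ U.powerset, ν W * chainMix {m} ent' 0 c d W) * (∑ W ∈ U.powerset, ν W * chainMix {m} ent' 0 c d W * x W) * (∑ W ∈ U.powerset, ν W * chainMix {m} ent' 1 c d' W * y W)
          + (∑ W ∈ U.powerset, ν W * chainMix {m} ent' 0 c d W * x W) * (∑ W ∈ U.powerset, ν W * chainMix {m} ent' 0 c d W * y W) * (∑ W ∈ U.powerset, ν W * chainMix {m} ent' 1 c d' W)) := by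
  have hx0 : ∀ W, 0 ≤ x W := fun W => by rw [hx W]; split_ifs <;> norm_num
  have hy0 : ∀ W, 0 ≤ y W := fun W => by rw [hy W]; split_ifs <;> norm_num
  have hxm : ∀ s t, x s ≤ x (s ∪ t) := fun s t => by
    rw [hx s, hx (s ∪ t)]
    by_cases h : j ∈ s
    · rw [if_pos h, if_pos (Finset.mem_union_left t h)]
    · rw [if_neg h]; split_ifs <;> norm_num
  have hym : ∀ s t, y s ≤ y (s ∪ t) := fun s t => by
    rw [hy s, hy (s ∪ t)]
    by_cases h : j' ∈ s
    · rw [if_pos h, if_pos (Finset.mem_union_left t h)]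
    · rw [if_neg h]; split_ifs <;> norm_num
  have hxI : ∀ W, (¬ ∃ r ∈ ({m} : Finset V) ∪ ent', r ∈ W) → x W = 0 := fun W hW => by
    rw [hx W]; exact if_neg (fun h => hW ⟨j, Finset.mem_union.2 (Or.inr hj), h⟩)
  have hyI : ∀ W, (¬ ∃ r ∈ ({m} : Finset V) ∪ ent', r ∈ W) → y W = 0 := fun W hW => by
    rw [hy W]; exact if_neg (fun h => hW ⟨j', Finset.mem_union.2 (Or.inr hj'), h⟩)
  have hcd0 : ∀ W, 0 ≤ c W - d W := fun W => by linarith [hdc W]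
  have hd'c : ∀ W, d' W ≤ c W := fun W => le_trans (hd'd W) (hdc W)
  have hcd' : ∀ s t, c s * d' t ≤ c (s ∩ t) * d' (s ∪ t) := gate_cd_law c d d' hc0 hd0 hd'0 hd'd hcd hdd'
  have FGM := cg_fact_GMg U m ent' ν c d d' hν0 hν hc0 hd0 hdc hd'0 hcd' hdd' x y hx0 hy0 hxm hym hxI hyI
  have FGMp := cg_fact_GMg U m ent' ν c d d' hν0 hν hc0 hd0 hdc hd'0 hcd' hdd' y x hy0 hx0 hym hxm hyI hxI
  have FGR1 := cg_fact_GR1 U m ent' ν c d' hν0 hν hc0 hd'0 hd'c hcd' hd'd' x y hx0 hy0 hxm hym hxI hyI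
  -- the moments of the two laws as region sums
  rw [cg_a0 U {m} ent' ν c d, cg_mom0 U {m} ent' ν c d x, cg_mom0 U {m} ent' ν c d y,
    cg_b0 U {m} ent' ν c d', cg_mom1 U {m} ent' ν c d' x, cg_mom1 U {m} ent' ν c d' y,
    cg_mom1 U {m} ent' ν c d' (fun W => x W * y W)]
  have hIx : (∑ W ∈ U.powerset.filter (fun W => ¬ ∃ r ∈ ({m} : Finset V) ∪ ent', r ∈ W), ν W * c W * x W) = 0 :=
    cgate_sum_zero U _ _ (fun W hW => by rw [hxI W hW, mul_zero])
  have hIy : (∑ W ∈ U.powerset.filter (fun W => ¬ ∃ r ∈ ({m} : Finset V) ∪ ent', r ∈ W), ν W * c W * y W) = 0 :=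
    cgate_sum_zero U _ _ (fun W hW => by rw [hyI W hW, mul_zero])
  have hIxy : (∑ W ∈ U.powerset.filter (fun W => ¬ ∃ r ∈ ({m} : Finset V) ∪ ent', r ∈ W), ν W * c W * (x W * y W)) = 0 :=
    cgate_sum_zero U _ _ (fun W hW => by rw [hxI W hW, zero_mul, mul_zero])
  rw [hIx, hIy, hIxy]
  rw [cg_split U ν c d (fun W => (¬ ∃ r ∈ ({m} : Finset V), r ∈ W) ∧ ∃ r ∈ ent', r ∈ W) x,
    cg_split U ν c d (fun W => (¬ ∃ r ∈ ({m} : Finset V), r ∈ W) ∧ ∃ r ∈ ent', r ∈ W) y,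
    cg_split' U ν c d (fun W => (¬ ∃ r ∈ ({m} : Finset V), r ∈ W) ∧ ∃ r ∈ ent', r ∈ W)]
  have eyxM : ∑ W ∈ U.powerset.filter (fun W => ∃ r ∈ ({m} : Finset V), r ∈ W), ν W * d' W * (y W * x W) =
      ∑ W ∈ U.powerset.filter (fun W => ∃ r ∈ ({m} : Finset V), r ∈ W), ν W * d' W * (x W * y W) :=
    Finset.sum_congr rfl (fun W _ => by ring)
  have eyxD : ∑ W ∈ U.powerset.filter (fun W => (¬ ∃ r ∈ ({m} : Finset V), r ∈ W) ∧ ∃ r ∈ ent', r ∈ W), ν W * d' W * (y W * x W) =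
      ∑ W ∈ U.powerset.filter (fun W => (¬ ∃ r ∈ ({m} : Finset V), r ∈ W) ∧ ∃ r ∈ ent', r ∈ W), ν W * d' W * (x W * y W) :=
    Finset.sum_congr rfl (fun W _ => by ring)
  rw [eyxM, eyxD] at FGMp
  -- name the parts
  set a := (∑ W ∈ U.powerset.filter (fun W => ¬ ∃ r ∈ ({m} : Finset V) ∪ ent', r ∈ W), ν W * c W) with ha_def
  set δ := (∑ W ∈ U.powerset.filter (fun W => (¬ ∃ r ∈ ({m} : Finset V), r ∈ W) ∧ ∃ r ∈ ent', r ∈ W), ν W * (c W - d W)) with hδ_def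
  set u := (∑ W ∈ U.powerset.filter (fun W => (¬ ∃ r ∈ ({m} : Finset V), r ∈ W) ∧ ∃ r ∈ ent', r ∈ W), ν W * d W) with hu_def
  set t := (∑ W ∈ U.powerset.filter (fun W => ∃ r ∈ ({m} : Finset V), r ∈ W), ν W * d W) with ht_def
  set XJ := (∑ W ∈ U.powerset.filter (fun W => (¬ ∃ r ∈ ({m} : Finset V), r ∈ W) ∧ ∃ r ∈ ent', r ∈ W), ν W * (c W - d W) * x W) with hXJ_def
  set XU := (∑ W ∈ U.powerset.filter (fun W => (¬ ∃ r ∈ ({m} : Finset V), r ∈ W) ∧ ∃ r ∈ ent', r ∈ W), ν W * d W * x W) with hXU_def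
  set XM := (∑ W ∈ U.powerset.filter (fun W => ∃ r ∈ ({m} : Finset V), r ∈ W), ν W * d W * x W) with hXM_def
  set YJ := (∑ W ∈ U.powerset.filter (fun W => (¬ ∃ r ∈ ({m} : Finset V), r ∈ W) ∧ ∃ r ∈ ent', r ∈ W), ν W * (c W - d W) * y W) with hYJ_def
  set YU := (∑ W ∈ U.powerset.filter (fun W => (¬ ∃ r ∈ ({m} : Finset V), r ∈ W) ∧ ∃ r ∈ ent', r ∈ W), ν W * d W * y W) with hYU_def
  set YM := (∑ W ∈ U.powerset.filter (fun W => ∃ r ∈ ({m} : Finset V), r ∈ W), ν W * d W * y W) with hYM_def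
  set wD := (∑ W ∈ U.powerset.filter (fun W => (¬ ∃ r ∈ ({m} : Finset V), r ∈ W) ∧ ∃ r ∈ ent', r ∈ W), ν W * d' W) with hwD_def
  set XWD := (∑ W ∈ U.powerset.filter (fun W => (¬ ∃ r ∈ ({m} : Finset V), r ∈ W) ∧ ∃ r ∈ ent', r ∈ W), ν W * d' W * x W) with hXWD_def
  set YWD := (∑ W ∈ U.powerset.filter (fun W => (¬ ∃ r ∈ ({m} : Finset V), r ∈ W) ∧ ∃ r ∈ ent', r ∈ W), ν W * d' W * y W) with hYWD_def
  set XYWD := (∑ W ∈ U.powerset.filter (fun W => (¬ ∃ r ∈ ({m} : Finset V), r ∈ W) ∧ ∃ r ∈ ent', r ∈ W), ν W * d' W * (x W * y W)) with hXYWD_def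
  set wM := (∑ W ∈ U.powerset.filter (fun W => ∃ r ∈ ({m} : Finset V), r ∈ W), ν W * d' W) with hwM_def
  set XWM := (∑ W ∈ U.powerset.filter (fun W => ∃ r ∈ ({m} : Finset V), r ∈ W), ν W * d' W * x W) with hXWM_def
  set YWM := (∑ W ∈ U.powerset.filter (fun W => ∃ r ∈ ({m} : Finset V), r ∈ W), ν W * d' W * y W) with hYWM_def
  set XYWM := (∑ W ∈ U.powerset.filter (fun W => ∃ r ∈ ({m} : Finset V), r ∈ W), ν W * d' W * (x W * y W)) with hXYWM_def
  have ha : 0 ≤ a := Finset.sum_nonneg (fun W _ => mul_nonneg (hν0 W) (hc0 W))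
  have hδ : 0 ≤ δ := Finset.sum_nonneg (fun W _ => mul_nonneg (hν0 W) (hcd0 W))
  have hu : 0 ≤ u := Finset.sum_nonneg (fun W _ => mul_nonneg (hν0 W) (hd0 W))
  have ht : 0 ≤ t := Finset.sum_nonneg (fun W _ => mul_nonneg (hν0 W) (hd0 W))
  have hXJ : 0 ≤ XJ := Finset.sum_nonneg (fun W _ => mul_nonneg (mul_nonneg (hν0 W) (hcd0 W)) (hx0 W))
  have hXU : 0 ≤ XU := Finset.sum_nonneg (fun W _ => mul_nonneg (mul_nonneg (hν0 W) (hd0 W)) (hx0 W))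
  have hXM : 0 ≤ XM := Finset.sum_nonneg (fun W _ => mul_nonneg (mul_nonneg (hν0 W) (hd0 W)) (hx0 W))
  have hYJ : 0 ≤ YJ := Finset.sum_nonneg (fun W _ => mul_nonneg (mul_nonneg (hν0 W) (hcd0 W)) (hy0 W))
  have hYU : 0 ≤ YU := Finset.sum_nonneg (fun W _ => mul_nonneg (mul_nonneg (hν0 W) (hd0 W)) (hy0 W))
  have hYM : 0 ≤ YM := Finset.sum_nonneg (fun W _ => mul_nonneg (mul_nonneg (hν0 W) (hd0 W)) (hy0 W))
  have hwD : 0 ≤ wD := Finset.sum_nonneg (fun W _ => mul_nonneg (hν0 W) (hd'0 W))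
  have hwM : 0 ≤ wM := Finset.sum_nonneg (fun W _ => mul_nonneg (hν0 W) (hd'0 W))
  have key := cov_nonneg_of_three_facts (a + δ + u + t) (XJ + XU + XM) (YJ + YU + YM) (a + wD + wM) (XWD + XWM) (YWD + YWM) (XYWD + XYWM)
    (by linarith) (by linarith) (by linarith) (by linarith)
    (by linarith [FGM]) (by linarith [FGMp]) (by linarith [FGR1])
  linarith [key]

end CovChain

end Summit.Ventures.PercRepro2.Coin
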